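import Literature.NumberTheory.Automorphic.LocalWeylLaw

/-!
# The approximate identity of normalised ball kernels on `ℍ`
(Iwaniec, *Spectral Methods of Automorphic Forms*, GSM 53, proof of Proposition 7.2 (the kernel
`𝟙_{[0,δ]}`, `h(i/2) = 4πδ`, `|h(t) − h(i/2)| ≤ 4|s|√δ h(i/2)`), PDF p. 73; Theorem 7.4, PDF p. 75)

Part of the `provefact` decomposition of `Literature.NumberTheory.Automorphic.Iwaniec2002_thm_7_4_modular`
(`ModularPretrace.lean`). The spectral expansion (7.17) of an automorphic kernel `K_k(z, w)` will be
obtained *pointwise* by pairing `K_k(·, w)` in `L²(𝒟)` with the automorphic kernels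
`K_{δ}(·, z)` of the normalised ball kernels `k_δ = (4πδ)⁻¹ 𝟙_{[0,δ]}` and letting `δ → 0`: on the
geometric side `(4πδ)⁻¹ ⟨K_k(·, w), K_δ(·, z)⟩ = 2 (4πδ)⁻¹ ∫_ℍ K_k(v, w) 𝟙_{u(z,v) ≤ δ} dμ(v) → 2 K_k(z, w)`,
on the spectral side the Selberg transforms `h_δ(t)/(4πδ) → 1` boundedly. This file proves the two
`δ → 0` limits (everything PROVED, nothing vendored):

1. **The Selberg transform of the ball kernel** `h_δ(t) = ∫_ℍ 𝟙_{u(i,z) ≤ δ} y^{½+it} dμ`: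
   `‖h_δ(t) − 4πδ‖ ≤ 16 ‖½ + it‖ √δ · 4πδ` (`norm_selbergTransform_ballKernel_sub_le`, the upper
   half of Iwaniec's two-sided estimate), `‖h_δ(t)‖ ≤ 2 · 4πδ` for real `t`
   (`norm_selbergTransform_ballKernel_le`), hence `h_δ(t)/(4πδ) → 1` as `δ → 0⁺`
   (`tendsto_selbergTransform_ballKernel_div`).
2. **The approximate identity**: for `F` locally integrable on `ℍ` and continuous at `z`,
   `(4πδ)⁻¹ ∫_ℍ 𝟙_{u(z,v) ≤ δ} F(v) dμ(v) → F(z)` (`tendsto_invariantOperator_ballKernel_div`).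

Literature: `ballKernel`, `isTestKernel_ballKernel`, `integral_ballKernel_pointPairInv`,
`abs_im_sub_one_le`, `norm_cpow_sub_one_le` (`LocalWeylLaw.lean`); `selbergTransform_eq_integral`,
`invariantOperator`, `integrable_kernel_mul` (`InvariantIntegralOperators.lean`);
`dist_le_of_pointPairInv_le` (`AutomorphicKernel.lean`).

## References
* [Iwaniec2002] H. Iwaniec, *Spectral Methods of Automorphic Forms*, 2nd ed., GSM 53, AMS 2002,
  proof of Prop. 7.2, PDF p. 73; Thm 7.4, PDF p. 75.
-/

noncomputable section

namespace Literature.NumberTheory.Automorphic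

open MeasureTheory Set Filter Real UpperHalfPlane
open scoped _root_.Topology _root_.ComplexConjugate

/-! ## 1. The Selberg transform of the ball kernel -/

section BallTransform

variable {δ : ℝ}

/-- On the ball `u(i, z) ≤ δ ≤ 1/64` the height satisfies `|y − 1| ≤ 4√δ ≤ ½` and `√y ≤ 2`. [folklore] -/
theorem sqrt_im_le_two_of_pointPairInv_le (hδ : 0 ≤ δ) (hδ' : δ ≤ 1 / 64) {z : ℍ}
    (h : pointPairInv UpperHalfPlane.I z ≤ δ) : Real.sqrt z.im ≤ 2 := by
  have h1 := abs_im_sub_one_le hδ (by linarith) h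
  have hs : Real.sqrt δ ≤ 1 / 8 := by
    rw [show (1 / 8 : ℝ) = Real.sqrt (1 / 64) by rw [show (1 / 64 : ℝ) = (1 / 8) ^ 2 by norm_num, Real.sqrt_sq (by norm_num)]]
    exact Real.sqrt_le_sqrt hδ'
  have hy : z.im ≤ 4 := by linarith [(abs_le.mp h1).2]
  calc Real.sqrt z.im ≤ Real.sqrt 4 := Real.sqrt_le_sqrt hy
    _ = 2 := by rw [show (4 : ℝ) = 2 ^ 2 by norm_num, Real.sqrt_sq (by norm_num)]

/-- **`‖h_δ(t)‖ ≤ 2 · 4πδ` for real `t`** (`|y^{½+it}| = √y ≤ 2` on the ball, `∫ 𝟙_{u ≤ δ} dμ = 4πδ`).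
[cite: Iwaniec2002, proof of Prop. 7.2, PDF p. 73] -/
theorem norm_selbergTransform_ballKernel_le (hδ : 0 < δ) (hδ' : δ ≤ 1 / 64) (t : ℝ) :
    ‖selbergTransform (ballKernel δ) t‖ ≤ 2 * (4 * π * δ) := by
  have hk := isTestKernel_ballKernel hδ.le
  rw [selbergTransform_eq_integral hk, ← integral_ballKernel_pointPairInv hδ.le UpperHalfPlane.I, ← integral_const_mul]
  refine norm_integral_le_of_norm_le ((integrable_kernel_mul hk (locallyIntegrable_const (1 : ℂ)) UpperHalfPlane.I).norm.const_mul 2 |>.congr ?_) ?_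
  · refine Eventually.of_forall fun w => ?_
    simp only [mul_one, Complex.norm_real, Real.norm_eq_abs, abs_of_nonneg (ballKernel_nonneg δ _)]
  · refine Eventually.of_forall fun w => ?_
    rw [norm_mul, Complex.norm_real, Real.norm_eq_abs, abs_of_nonneg (ballKernel_nonneg δ _)]
    by_cases hw : pointPairInv UpperHalfPlane.I w ≤ δ
    · rw [Complex.norm_cpow_eq_rpow_re_of_pos w.im_pos]
      have hre : ((1 / 2 : ℂ) + Complex.I * t).re = 1 / 2 := by simp
      rw [hre, ← Real.sqrt_eq_rpow]
      have := sqrt_im_le_two_of_pointPairInv_le hδ.le hδ' hw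
      have hb := ballKernel_nonneg δ (pointPairInv UpperHalfPlane.I w)
      nlinarith
    · rw [ballKernel_of_gt (not_le.mp hw)]; simp

/-- **`‖h_δ(t) − 4πδ‖ ≤ 16‖s‖√δ · 4πδ`, `s = ½ + it`** (for `32‖s‖√δ ≤ 1`, `δ ≤ 1/64`): the upper half
of Iwaniec's `2πδ < |h(t)| < 6πδ`. [cite: Iwaniec2002, proof of Prop. 7.2, PDF p. 73] -/
theorem norm_selbergTransform_ballKernel_sub_le (hδ : 0 < δ) (hδ' : δ ≤ 1 / 64) (t : ℂ)
    (hs : ‖(1 / 2 : ℂ) + Complex.I * t‖ * (32 * Real.sqrt δ) ≤ 1) :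
    ‖selbergTransform (ballKernel δ) t - ((4 * π * δ : ℝ) : ℂ)‖ ≤
      16 * ‖(1 / 2 : ℂ) + Complex.I * t‖ * Real.sqrt δ * (4 * π * δ) := by
  set s : ℂ := (1 / 2 : ℂ) + Complex.I * t with hsdef
  have hk := isTestKernel_ballKernel hδ.le
  have hvol := integral_ballKernel_pointPairInv hδ.le UpperHalfPlane.I
  have hint1 : Integrable (fun w : ℍ => (ballKernel δ (pointPairInv UpperHalfPlane.I w) : ℂ) * ((w.im : ℝ) : ℂ) ^ s) :=
    integrable_kernel_mul hk ((Complex.continuous_ofReal.comp UpperHalfPlane.continuous_im).cpow continuous_const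
      (fun w => Or.inl (by exact_mod_cast w.im_pos))).locallyIntegrable UpperHalfPlane.I
  have hint0 : Integrable (fun w : ℍ => (ballKernel δ (pointPairInv UpperHalfPlane.I w) : ℂ) * (1 : ℂ)) :=
    integrable_kernel_mul hk (locallyIntegrable_const (1 : ℂ)) UpperHalfPlane.I
  have hrepr : selbergTransform (ballKernel δ) t - ((4 * π * δ : ℝ) : ℂ) =
      ∫ w : ℍ, (ballKernel δ (pointPairInv UpperHalfPlane.I w) : ℂ) * (((w.im : ℝ) : ℂ) ^ s - 1) := by
    rw [selbergTransform_eq_integral hk, ← hsdef]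
    have e0 : (((4 * π * δ : ℝ)) : ℂ) = ∫ w : ℍ, (ballKernel δ (pointPairInv UpperHalfPlane.I w) : ℂ) * (1 : ℂ) := by
      simp_rw [mul_one]
      rw [integral_complex_ofReal, hvol]
    rw [e0, ← integral_sub hint1 hint0]
    congr 1 with w; ring
  rw [hrepr]
  have hη : 4 * Real.sqrt δ ≤ 1 / 2 := by
    have : Real.sqrt δ ≤ 1 / 8 := by
      rw [show (1 / 8 : ℝ) = Real.sqrt (1 / 64) by
        rw [show (1 / 64 : ℝ) = (1 / 8) ^ 2 by norm_num, Real.sqrt_sq (by norm_num)]]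
      exact Real.sqrt_le_sqrt hδ'
    linarith
  calc ‖∫ w : ℍ, (ballKernel δ (pointPairInv UpperHalfPlane.I w) : ℂ) * (((w.im : ℝ) : ℂ) ^ s - 1)‖
      ≤ ∫ w : ℍ, (16 * ‖s‖ * Real.sqrt δ) * ballKernel δ (pointPairInv UpperHalfPlane.I w) := by
        refine norm_integral_le_of_norm_le ?_ (Eventually.of_forall fun w => ?_)
        · have := (integrable_kernel_mul hk (locallyIntegrable_const (1 : ℂ)) UpperHalfPlane.I).norm.const_mul (16 * ‖s‖ * Real.sqrt δ)
          refine this.congr (Eventually.of_forall fun w => ?_)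
          simp only [mul_one, Complex.norm_real, Real.norm_eq_abs, abs_of_nonneg (ballKernel_nonneg δ _)]
        · rw [norm_mul, Complex.norm_real, Real.norm_eq_abs, abs_of_nonneg (ballKernel_nonneg δ _)]
          by_cases hw : pointPairInv UpperHalfPlane.I w ≤ δ
          · have h1 := abs_im_sub_one_le hδ.le (by linarith) hw
            have h2 := norm_cpow_sub_one_le (s := s) w.im_pos h1 hη (by nlinarith [norm_nonneg s])
            have hb := ballKernel_nonneg δ (pointPairInv UpperHalfPlane.I w)
            calc ballKernel δ (pointPairInv UpperHalfPlane.I w) * ‖((w.im : ℝ) : ℂ) ^ s - 1‖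
                ≤ ballKernel δ (pointPairInv UpperHalfPlane.I w) * (4 * ‖s‖ * (4 * Real.sqrt δ)) :=
                  mul_le_mul_of_nonneg_left h2 hb
              _ = (16 * ‖s‖ * Real.sqrt δ) * ballKernel δ (pointPairInv UpperHalfPlane.I w) := by ring
          · rw [ballKernel_of_gt (not_le.mp hw)]; simp
    _ = 16 * ‖s‖ * Real.sqrt δ * (4 * π * δ) := by rw [integral_const_mul, hvol]

/-- **`h_δ(t)/(4πδ) → 1` as `δ → 0⁺`** for every fixed `t`. [cite: Iwaniec2002, proof of Prop. 7.2, PDF p. 73] -/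
theorem tendsto_selbergTransform_ballKernel_div (t : ℂ) :
    Tendsto (fun δ : ℝ => selbergTransform (ballKernel δ) t / ((4 * π * δ : ℝ) : ℂ)) (𝓝[>] 0) (𝓝 1) := by
  set s : ℂ := (1 / 2 : ℂ) + Complex.I * t with hsdef
  rw [Metric.tendsto_nhdsWithin_nhds]
  intro ε hε
  -- choose δ₀ with `16‖s‖√δ₀ ≤ ε/2` and the side conditions
  set A : ℝ := 16 * ‖s‖ + 32 * ‖s‖ + 1 with hA
  have hA0 : 0 < A := by rw [hA]; positivity
  set η : ℝ := min (1 / 64) (min (ε / (2 * A)) 1 ^ 2 / A ^ 2) with hηdef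
  have hη0 : 0 < η := by rw [hηdef]; positivity
  refine ⟨η, hη0, fun δ hδ0 hδη => ?_⟩
  have hδ0' : 0 < δ := hδ0
  rw [dist_eq_norm, Real.norm_eq_abs, sub_zero, abs_of_pos hδ0'] at hδη
  have hδ64 : δ ≤ 1 / 64 := le_trans hδη.le (min_le_left _ _)
  have hsq : Real.sqrt δ ≤ min (ε / (2 * A)) 1 / A := by
    have h1 : δ ≤ (min (ε / (2 * A)) 1 / A) ^ 2 := by
      have := le_trans hδη.le (min_le_right _ _)
      rwa [div_pow]
    calc Real.sqrt δ ≤ Real.sqrt ((min (ε / (2 * A)) 1 / A) ^ 2) := Real.sqrt_le_sqrt h1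
      _ = min (ε / (2 * A)) 1 / A := Real.sqrt_sq (by positivity)
  have hAs : A * Real.sqrt δ ≤ min (ε / (2 * A)) 1 := by
    rw [mul_comm]; exact (le_div_iff₀ hA0).mp hsq
  have hside : ‖s‖ * (32 * Real.sqrt δ) ≤ 1 := by
    have : 32 * ‖s‖ ≤ A := by rw [hA]; linarith [norm_nonneg s]
    calc ‖s‖ * (32 * Real.sqrt δ) = (32 * ‖s‖) * Real.sqrt δ := by ring
      _ ≤ A * Real.sqrt δ := mul_le_mul_of_nonneg_right this (Real.sqrt_nonneg _)
      _ ≤ 1 := hAs.trans (min_le_right _ _)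
  have hmain := norm_selbergTransform_ballKernel_sub_le hδ0' hδ64 t hside
  have hc : (((4 * π * δ : ℝ)) : ℂ) ≠ 0 := by
    have : (0 : ℝ) < 4 * π * δ := by positivity
    exact_mod_cast this.ne'
  rw [dist_eq_norm, div_sub_one hc, norm_div, Complex.norm_real, Real.norm_of_nonneg (by positivity),
    div_lt_iff₀ (by positivity)]
  refine lt_of_le_of_lt hmain ?_
  have h16 : 16 * ‖s‖ * Real.sqrt δ ≤ ε / 2 := by
    have : 16 * ‖s‖ ≤ A := by rw [hA]; linarith [norm_nonneg s]
    calc 16 * ‖s‖ * Real.sqrt δ ≤ A * Real.sqrt δ := mul_le_mul_of_nonneg_right this (Real.sqrt_nonneg _)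
      _ ≤ ε / (2 * A) := hAs.trans (min_le_left _ _)
      _ ≤ ε / 2 := by
          have : 1 ≤ A := by rw [hA]; linarith [norm_nonneg s]
          exact div_le_div_of_nonneg_left hε.le two_pos (by nlinarith)
  have hpos : 0 < 4 * π * δ := by positivity
  nlinarith

end BallTransform

/-! ## 2. The approximate identity -/

/-- **Normalised ball averages converge to the value at the centre**: for `F` locally integrable on
`ℍ` and continuous at `z`, `(4πδ)⁻¹ ∫_ℍ 𝟙_{u(z,v) ≤ δ} F(v) dμ(v) → F(z)` as `δ → 0⁺`
(`∫_ℍ 𝟙_{u(z,·) ≤ δ} dμ = 4πδ`, the balls `{u(z, ·) ≤ δ}` shrink to `z`). [cite: Iwaniec2002, Thm 7.4 (proof), PDF p. 75] -/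
theorem tendsto_invariantOperator_ballKernel_div {F : ℍ → ℂ} (hF : LocallyIntegrable F) {z : ℍ}
    (hFz : ContinuousAt F z) :
    Tendsto (fun δ : ℝ => invariantOperator (ballKernel δ) F z / ((4 * π * δ : ℝ) : ℂ)) (𝓝[>] 0) (𝓝 (F z)) := by
  rw [Metric.tendsto_nhds]
  intro ε hε
  -- continuity: `‖F v - F z‖ < ε/2` on a metric ball of radius `ρ`
  obtain ⟨ρ, hρ, hball⟩ : ∃ ρ > 0, ∀ v, dist v z < ρ → ‖F v - F z‖ < ε / 2 := by
    obtain ⟨ρ, hρ, h⟩ := Metric.continuousAt_iff.mp hFz (ε / 2) (half_pos hε)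
    exact ⟨ρ, hρ, fun v hv => by rw [← dist_eq_norm]; exact h hv⟩
  -- `2 arsinh √δ < ρ` for small `δ > 0`
  have hc : Tendsto (fun δ : ℝ => 2 * Real.arsinh (Real.sqrt δ)) (𝓝[>] 0) (𝓝 (2 * Real.arsinh (Real.sqrt 0))) :=
    (((Real.continuous_arsinh.comp Real.continuous_sqrt).const_mul 2).tendsto 0).mono_left nhdsWithin_le_nhds
  rw [Real.sqrt_zero, Real.arsinh_zero, mul_zero] at hc
  filter_upwards [hc (Iio_mem_nhds hρ), self_mem_nhdsWithin] with δ hδρ hδ0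
  have hδ0' : (0 : ℝ) < δ := hδ0
  have hδρ' : 2 * Real.arsinh (Real.sqrt δ) < ρ := hδρ
  have hk := isTestKernel_ballKernel hδ0'.le
  have hvol := integral_ballKernel_pointPairInv hδ0'.le z
  have hc0 : (((4 * π * δ : ℝ)) : ℂ) ≠ 0 := by
    have : (0 : ℝ) < 4 * π * δ := by positivity
    exact_mod_cast this.ne'
  -- `avg - F z = (4πδ)⁻¹ ∫ 𝟙 (F v - F z)`
  have hint1 : Integrable (fun v : ℍ => (ballKernel δ (pointPairInv z v) : ℂ) * F v) := integrable_kernel_mul hk hF z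
  have hint0 : Integrable (fun v : ℍ => (ballKernel δ (pointPairInv z v) : ℂ) * (1 : ℂ)) :=
    integrable_kernel_mul hk (locallyIntegrable_const (1 : ℂ)) z
  have hrepr : invariantOperator (ballKernel δ) F z - ((4 * π * δ : ℝ) : ℂ) * F z =
      ∫ v : ℍ, (ballKernel δ (pointPairInv z v) : ℂ) * (F v - F z) := by
    unfold invariantOperator
    have e0 : (((4 * π * δ : ℝ)) : ℂ) * F z = ∫ v : ℍ, (ballKernel δ (pointPairInv z v) : ℂ) * (1 : ℂ) * F z := by
      rw [integral_mul_const]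
      simp_rw [mul_one]
      rw [integral_complex_ofReal, hvol]
    rw [e0, ← integral_sub hint1 (hint0.mul_const _)]
    congr 1 with v; ring
  have hbound : ‖invariantOperator (ballKernel δ) F z - ((4 * π * δ : ℝ) : ℂ) * F z‖ ≤ ε / 2 * (4 * π * δ) := by
    rw [hrepr]
    calc ‖∫ v : ℍ, (ballKernel δ (pointPairInv z v) : ℂ) * (F v - F z)‖
        ≤ ∫ v : ℍ, (ε / 2) * ballKernel δ (pointPairInv z v) := by
          refine norm_integral_le_of_norm_le ?_ (Eventually.of_forall fun v => ?_)
          · have := (integrable_kernel_mul hk (locallyIntegrable_const (1 : ℂ)) z).norm.const_mul (ε / 2)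
            refine this.congr (Eventually.of_forall fun v => ?_)
            simp only [mul_one, Complex.norm_real, Real.norm_eq_abs, abs_of_nonneg (ballKernel_nonneg δ _)]
          · rw [norm_mul, Complex.norm_real, Real.norm_eq_abs, abs_of_nonneg (ballKernel_nonneg δ _)]
            by_cases hv : pointPairInv z v ≤ δ
            · have hd : dist v z < ρ := by
                rw [dist_comm]; exact lt_of_le_of_lt (dist_le_of_pointPairInv_le hv) hδρ'
              have := (hball v hd).le
              have hb := ballKernel_nonneg δ (pointPairInv z v)
              calc ballKernel δ (pointPairInv z v) * ‖F v - F z‖ ≤ ballKernel δ (pointPairInv z v) * (ε / 2) :=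
                    mul_le_mul_of_nonneg_left this hb
                _ = ε / 2 * ballKernel δ (pointPairInv z v) := by ring
            · rw [ballKernel_of_gt (not_le.mp hv)]; simp
      _ = ε / 2 * (4 * π * δ) := by rw [integral_const_mul, hvol]
  rw [dist_eq_norm]
  have e : invariantOperator (ballKernel δ) F z / ((4 * π * δ : ℝ) : ℂ) - F z =
      (invariantOperator (ballKernel δ) F z - ((4 * π * δ : ℝ) : ℂ) * F z) / ((4 * π * δ : ℝ) : ℂ) := by
    field_simp
  rw [e, norm_div, Complex.norm_real, Real.norm_of_nonneg (by positivity), div_lt_iff₀ (by positivity)]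
  have hpos : 0 < 4 * π * δ := by positivity
  nlinarith

end Literature.NumberTheory.Automorphic

end
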